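import Summits.Ventures.PercRepro.SixFourResidueGenericCert
import Summits.Ventures.PercRepro.SixFourT4Generic

/-!
# PercRepro — C-025 at `(6,4)`: `J₄ ≥ 0` for GENERIC solids with `7 ≤ g ≤ 9` (p2, gen 8 — §21.18.2 (a))

The (α) generic half of the `g ≤ 9` clause of `SixFourResidue`: p3's `J_four_nonneg_of_generic` (§22.5,
`SixFourT4Generic.lean`, `10 ≤ g ≤ 14`) re-run with the small-`g` price certificate of
`SixFourResidueGenericCert.lean`.  A generic solid has every plane trace `≤ g − 3 ≤ 6` points (`card_trace_le_of_generic`),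
so the `≤ 7` hypotheses of §22.2–22.4 are available; §22.4 (a)'s `Ξ_g` bound used `g ≥ 10` only to keep
`|λ| ≤ 6`, which the generic trace bound `p + 3 ≤ g` gives for `g ≤ 10` (`two_mul_card_fiber_le_xiProf_K`,
`Xcnt_le_sum_xiProf_K`).
Main result: `J_four_nonneg_of_generic_small : 7 ≤ g ≤ 9 → Generic M G → 0 ≤ J₄(G)`.
-/

namespace PercRepro.SixFour

open Finset ThmH

variable {α : Type*} [DecidableEq α] {M : Matroid α} [M.Finite] {G : Finset α}

/-! ## Generic solids have plane traces `≤ g − 3` -/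

/-- Every plane trace of a generic solid misses at least `3` points of `G`. -/
theorem card_trace_add_three_le_of_generic (hgen : Generic M G) {P : Finset α} (hP : P ∈ planes M) :
    (P ∩ G).card + 3 ≤ G.card := by
  have h := hgen P hP
  have hle := M.eRk_le_encard ((G \ P : Finset α) : Set α)
  rw [Set.encard_coe_eq_coe_finsetCard] at hle
  have h3 : (3 : ℕ∞) ≤ ((G \ P).card : ℕ∞) := h.trans hle
  have h3' : 3 ≤ (G \ P).card := by exact_mod_cast h3
  have := Finset.card_sdiff_add_card_inter G P
  rw [Finset.inter_comm] at this
  omega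

/-! ## §22.4 (a) without `g ≥ 10` -/

/-- For a plane `ψ` at least as large as its partner: `2·#fiber ψ ≤ Ξ_g(ψ)` (profile form; plane traces
`≤ g − 3`, `g ≤ 10`). -/
theorem two_mul_card_fiber_le_xiProf_K (hs : Simple M) (hG : G ⊆ gr M) (hr : M.eRk (G : Set α) = 4)
    (hgen : Generic M G) (hpl : ∀ P ∈ planes M, (P ∩ G).card + 3 ≤ G.card) (hg10 : G.card ≤ 10) {P : Finset α}
    (hP : P ∈ planes M) (hlarge : (partner M G P ∩ G).card ≤ (P ∩ G).card) :
    2 * (fiber M G P).card ≤ xiProf G.card (P ∩ G).card (inc M (P ∩ G) 2) (inc M (P ∩ G) 3) (inc M (P ∩ G) 4)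
      (inc M (P ∩ G) 5) (inc M (P ∩ G) 6) := by
  by_cases hne : (fiber M G P).Nonempty
  · have hfl := card_fiber_le hG hr hgen hP
    have hlam := card_lambda hG hr hgen hP hne
    have hp7 := hpl P hP
    have hp'7 : (partner M G P ∩ G).card + 3 ≤ G.card := by
      obtain ⟨Z, hZ⟩ := hne
      exact hpl _ (fiber_facts hG hr hgen hP hZ).2.1
    have h6 : (lambda M G P).card ≤ 6 := by omega
    have hadm := lambda_admissible hs hG hr hgen hP hne h6
    have hb : (lambda M G P).card ≤ min (2 * (P ∩ G).card - G.card) (7 + (P ∩ G).card - G.card) := by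
      rw [Nat.le_min]; omega
    have hle := le_lamMax G.card (P ∩ G).card (inc M (P ∩ G) 2) (inc M (P ∩ G) 3) (inc M (P ∩ G) 4)
      (inc M (P ∩ G) 5) (inc M (P ∩ G) 6) (lambda M G P).card h6 hadm hb
    unfold xiProf
    rw [if_neg (by omega)]
    calc 2 * (fiber M G P).card ≤ 2 * 2 ^ (lambda M G P).card := by omega
      _ = 2 ^ ((lambda M G P).card + 1) := by ring
      _ ≤ 2 ^ (1 + lamMax G.card (P ∩ G).card (inc M (P ∩ G) 2) (inc M (P ∩ G) 3) (inc M (P ∩ G) 4)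
          (inc M (P ∩ G) 5) (inc M (P ∩ G) 6)) := Nat.pow_le_pow_right (by norm_num) (by omega)
  · rw [Finset.not_nonempty_iff_eq_empty] at hne
    rw [hne, Finset.card_empty, mul_zero]
    exact Nat.zero_le _

/-- **§22.4 (a) in profile form for `g ≤ 10`**: for a generic `G` with all plane traces `≤ g − 3` points,
`X ≤ Σ_{P ∈ planes M, r(P ∩ G) = 3} Ξ_g(P ∩ G)`. -/
theorem Xcnt_le_sum_xiProf_K (hs : Simple M) (hG : G ⊆ gr M) (hr : M.eRk (G : Set α) = 4) (hgen : Generic M G)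
    (hpl : ∀ P ∈ planes M, (P ∩ G).card + 3 ≤ G.card) (hg10 : G.card ≤ 10) :
    Xcnt M G ≤ ∑ P ∈ (planes M).filter (fun P : Finset α => M.eRk ((P ∩ G : Finset α) : Set α) = 3),
      xiProf G.card (P ∩ G).card (inc M (P ∩ G) 2) (inc M (P ∩ G) 3) (inc M (P ∩ G) 4) (inc M (P ∩ G) 5)
        (inc M (P ∩ G) 6) := by
  rw [Xcnt_eq_card_Xset, card_Xset_eq_sum_fiber hG hr hgen]
  rw [← Finset.sum_filter_add_sum_filter_not (planes M)
    (fun P : Finset α => (partner M G P ∩ G).card ≤ (P ∩ G).card) (fun P => (fiber M G P).card)]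
  have hsmall := sum_fiber_small_le hG hr hgen
  set A := (planes M).filter (fun P : Finset α => (partner M G P ∩ G).card ≤ (P ∩ G).card) with hA
  set A' := A.filter (fun P : Finset α => (fiber M G P).Nonempty) with hA'
  have h1 : ∑ P ∈ A, (fiber M G P).card = ∑ P ∈ A', (fiber M G P).card :=
    (Finset.sum_filter_of_ne (fun P _ hne => Finset.card_pos.1 (Nat.pos_of_ne_zero hne))).symm
  have hlarge : ∑ P ∈ A', 2 * (fiber M G P).card ≤ ∑ P ∈ A',
      xiProf G.card (P ∩ G).card (inc M (P ∩ G) 2) (inc M (P ∩ G) 3) (inc M (P ∩ G) 4) (inc M (P ∩ G) 5)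
        (inc M (P ∩ G) 6) :=
    Finset.sum_le_sum (fun P hP => by
      rw [hA', Finset.mem_filter, hA, Finset.mem_filter] at hP
      exact two_mul_card_fiber_le_xiProf_K hs hG hr hgen hpl hg10 hP.1.1 hP.1.2)
  rw [← Finset.mul_sum] at hlarge
  have hsub : A' ⊆ (planes M).filter (fun P : Finset α => M.eRk ((P ∩ G : Finset α) : Set α) = 3) := by
    intro P hP
    rw [hA', Finset.mem_filter, hA, Finset.mem_filter] at hP
    rw [Finset.mem_filter]
    exact ⟨hP.1.1, eRk_trace_eq_three_of_fiber_nonempty hG hr hgen hP.1.1 hP.2⟩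
  have hsub' := Finset.sum_le_sum_of_subset_of_nonneg hsub
    (f := fun P => xiProf G.card (P ∩ G).card (inc M (P ∩ G) 2) (inc M (P ∩ G) 3) (inc M (P ∩ G) 4)
      (inc M (P ∩ G) 5) (inc M (P ∩ G) 6)) (fun _ _ _ => Nat.zero_le _)
  omega

/-! ## The certificate summed over the planes, with the small-`g` prices -/

/-- One term of the right side of `(C_τ)` with the small-`g` prices: `y_m·inc_m·(p − m)`. -/
noncomputable def certTermS (M : Matroid α) [M.Finite] (G P : Finset α) (g m : ℕ) : ℚ :=
  yPriceS g m * (inc M (P ∩ G) m : ℚ) * (((P ∩ G).card - m : ℕ) : ℚ)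

/-- The right side of `(C_τ)` for the plane `P` with the small-`g` prices. -/
noncomputable def certRHSS (M : Matroid α) [M.Finite] (G P : Finset α) (g : ℕ) : ℚ :=
  certTermS M G P g 2 + certTermS M G P g 3 + certTermS M G P g 4 + certTermS M G P g 5 + certTermS M G P g 6

/-- `(C_τ)` for a rank-`3` plane trace with `p + 3 ≤ g`, in the plane vocabulary. -/
theorem cert_plane_S (hs : Simple M) (hG : G ⊆ gr M) (hg : 7 ≤ G.card) (hg' : G.card ≤ 9) {P : Finset α}
    (hp : (P ∩ G).card + 3 ≤ G.card) (hr : M.eRk ((P ∩ G : Finset α) : Set α) = 3) :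
    cost M G P + 6 / 5 * (xiProf G.card (P ∩ G).card (inc M (P ∩ G) 2) (inc M (P ∩ G) 3) (inc M (P ∩ G) 4)
      (inc M (P ∩ G) 5) (inc M (P ∩ G) 6) : ℚ) + 2 / 3 * (lppCredit M G P : ℚ) ≤ certRHSS M G P G.card := by
  have h7 : (P ∩ G).card ≤ 7 := by omega
  have hc := certQ_of_trace_S hs hG hg hg' hp hr
  unfold CertQS at hc
  rw [← D3_eq_D3Prof hs hG h7 hr, ← r34_eq_r34Prof hs hG h7 hr, ← sum_eps_eq_lppProf hr h7] at hc
  unfold cost certRHSS certTermS lppCredit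
  linarith

/-- The right side is nonnegative. -/
theorem certRHSS_nonneg (G P : Finset α) {g : ℕ} (hg : 7 ≤ g) (hg' : g ≤ 9) : 0 ≤ certRHSS M G P g := by
  unfold certRHSS certTermS
  have := yPriceS_nonneg hg hg'
  have h2 := this 2
  have h3 := this 3
  have h4 := this 4
  have h5 := this 5
  have h6 := this 6
  positivity

/-- `Σ_{P} certTermS m = y_m·(g − m)·b_m` (§22.3) for `2 ≤ m`. -/
theorem sum_certTermS_eq (hs : Simple M) (hG : G ⊆ gr M) (g : ℕ) {m : ℕ} (hm : 2 ≤ m) :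
    ∑ P ∈ planes M, certTermS M G P g m = yPriceS g m * ((G.card - m : ℕ) : ℚ) * (bLines M G m : ℚ) := by
  unfold certTermS
  have h := sum_inc_mul_eq hs hG (m := m) hm
  have h' : ∑ P ∈ planes M, ((inc M (P ∩ G) m * ((P ∩ G).card - m) : ℕ) : ℚ) =
      ((G.card - m : ℕ) : ℚ) * (bLines M G m : ℚ) := by
    rw [← Nat.cast_sum, h, Nat.cast_mul]
  rw [mul_assoc, ← h', Finset.mul_sum]
  refine Finset.sum_congr rfl (fun P _ => ?_)
  push_cast
  ring

/-! ## §22.5 at `g = 7, 8, 9` -/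

/-- **The (α) generic half of the `g ≤ 9` clause (§21.18.2 (a))**: for a generic rank-`4` set `G ⊆ E` of a simple
matroid with `7 ≤ g ≤ 9` points, `0 ≤ J₄(G)`. -/
theorem J_four_nonneg_of_generic_small (hs : Simple M) (hG : G ⊆ gr M) (hr : M.eRk (G : Set α) = 4)
    (hgen : Generic M G) (hg : 7 ≤ G.card) (hg' : G.card ≤ 9) : 0 ≤ J M G 4 := by
  have hpl3 : ∀ P ∈ planes M, (P ∩ G).card + 3 ≤ G.card := fun P hP =>
    card_trace_add_three_le_of_generic hgen hP
  set S := (planes M).filter (fun P : Finset α => M.eRk ((P ∩ G : Finset α) : Set α) = 3) with hS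
  have hg6 : 6 ≤ G.card := by omega
  -- F1: the identity
  have F1 := J_four_identity hs hG hr
  -- F2: the cost sum restricted to the rank-`3` planes
  have F2 := sum_cost_le (M := M) G
  -- F3: the certificate summed over `S`
  have F3 : ∑ P ∈ S, cost M G P + 6 / 5 * ∑ P ∈ S, (xiProf G.card (P ∩ G).card (inc M (P ∩ G) 2) (inc M (P ∩ G) 3)
      (inc M (P ∩ G) 4) (inc M (P ∩ G) 5) (inc M (P ∩ G) 6) : ℚ) + 2 / 3 * ∑ P ∈ S, (lppCredit M G P : ℚ) ≤
      ∑ P ∈ S, certRHSS M G P G.card := by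
    rw [Finset.mul_sum, Finset.mul_sum, ← Finset.sum_add_distrib, ← Finset.sum_add_distrib]
    refine Finset.sum_le_sum (fun P hP => ?_)
    obtain ⟨hP, hr3⟩ := Finset.mem_filter.1 hP
    exact cert_plane_S hs hG hg hg' (card_trace_add_three_le_of_generic hgen hP) hr3
  -- F4: extend the right side to all planes
  have F4 : ∑ P ∈ S, certRHSS M G P G.card ≤ ∑ P ∈ planes M, certRHSS M G P G.card :=
    Finset.sum_le_sum_of_subset_of_nonneg (Finset.filter_subset _ _) (fun P _ _ => certRHSS_nonneg G P hg hg')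
  -- F5 + F6: the right side as the line quantities, with the price identities
  have F56 : ∑ P ∈ planes M, certRHSS M G P G.card =
      yPS G.card * ∑ m ∈ Finset.Icc 2 6, (inc M G m : ℚ) * (m.choose 2 : ℚ) +
      ∑ m ∈ Finset.Icc 2 6, (inc M G m : ℚ) * bonus m +
      2 / 3 * ∑ m ∈ Finset.Icc 2 6, (inc M G m : ℚ) * ((eps m : ℚ) * ((G.card - m).choose 2 : ℚ)) := by
    unfold certRHSS
    simp only [Finset.sum_add_distrib]
    rw [sum_certTermS_eq hs hG _ (by norm_num), sum_certTermS_eq hs hG _ (by norm_num),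
      sum_certTermS_eq hs hG _ (by norm_num), sum_certTermS_eq hs hG _ (by norm_num),
      sum_certTermS_eq hs hG _ (by norm_num)]
    rw [price_identity_S hg hg' (by norm_num) (by norm_num), price_identity_S hg hg' (by norm_num) (by norm_num),
      price_identity_S hg hg' (by norm_num) (by norm_num), price_identity_S hg hg' (by norm_num) (by norm_num),
      price_identity_S hg hg' (by norm_num) (by norm_num)]
    rw [show Finset.Icc 2 6 = {2, 3, 4, 5, 6} from rfl]
    simp only [Finset.sum_insert (by decide : (2 : ℕ) ∉ ({3, 4, 5, 6} : Finset ℕ)),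
      Finset.sum_insert (by decide : (3 : ℕ) ∉ ({4, 5, 6} : Finset ℕ)),
      Finset.sum_insert (by decide : (4 : ℕ) ∉ ({5, 6} : Finset ℕ)),
      Finset.sum_insert (by decide : (5 : ℕ) ∉ ({6} : Finset ℕ)), Finset.sum_singleton]
    unfold bLines
    ring
  -- F7: the line-side bounds
  have F7a : ∑ m ∈ Finset.Icc 2 6, (inc M G m : ℚ) * (m.choose 2 : ℚ) ≤ (G.card.choose 2 : ℚ) := by
    have := sum_Icc_choose_two_le hs hG hg6
    have h' : ∑ m ∈ Finset.Icc 2 6, (inc M G m : ℚ) * (m.choose 2 : ℚ) =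
        ((∑ m ∈ Finset.Icc 2 6, inc M G m * m.choose 2 : ℕ) : ℚ) := by push_cast; rfl
    rw [h']
    exact_mod_cast this
  have F7b : ∑ m ∈ Finset.Icc 2 6, (inc M G m : ℚ) * bonus m ≤ ∑ L ∈ lines M, bonus (L ∩ G).card :=
    sum_Icc_inc_le_rat hg6 bonus (fun m => by unfold bonus; positivity)
  have F7c : ∑ m ∈ Finset.Icc 2 6, (inc M G m : ℚ) * ((eps m : ℚ) * ((G.card - m).choose 2 : ℚ)) ≤
      ∑ L ∈ lines M, ((eps (L ∩ G).card : ℚ) * ((G.card - (L ∩ G).card).choose 2 : ℚ)) :=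
    sum_Icc_inc_le_rat hg6 (fun m => (eps m : ℚ) * ((G.card - m).choose 2 : ℚ)) (fun m => by positivity)
  -- F8: the `X` bound
  have F8 : (Xcnt M G : ℚ) ≤ ∑ P ∈ S, (xiProf G.card (P ∩ G).card (inc M (P ∩ G) 2) (inc M (P ∩ G) 3)
      (inc M (P ∩ G) 4) (inc M (P ∩ G) 5) (inc M (P ∩ G) 6) : ℚ) := by
    have := Xcnt_le_sum_xiProf_K hs hG hr hgen hpl3 (by omega)
    rw [← hS] at this
    exact_mod_cast this
  -- F9: the `lpp` lower bound
  have F9 : ∑ L ∈ lines M, ((eps (L ∩ G).card : ℚ) * ((crossPairs M G L).card : ℚ)) ≤ (lpp M G : ℚ) := by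
    have := lpp_ge hs hG
    have h' : ∑ L ∈ lines M, ((eps (L ∩ G).card : ℚ) * ((crossPairs M G L).card : ℚ)) =
        ((∑ L ∈ lines M, eps (L ∩ G).card * (crossPairs M G L).card : ℕ) : ℚ) := by push_cast; rfl
    rw [h']
    exact_mod_cast this
  -- F10: the lpp credit
  have F10 : ∑ L ∈ lines M, ((eps (L ∩ G).card : ℚ) * ((G.card - (L ∩ G).card).choose 2 : ℚ)) ≤
      ∑ L ∈ lines M, ((eps (L ∩ G).card : ℚ) * ((crossPairs M G L).card : ℚ)) + ∑ P ∈ S, (lppCredit M G P : ℚ) := by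
    have := sum_eps_choose_le hs hG
    rw [← hS] at this
    have h1 : ∑ L ∈ lines M, ((eps (L ∩ G).card : ℚ) * ((G.card - (L ∩ G).card).choose 2 : ℚ)) =
        ((∑ L ∈ lines M, eps (L ∩ G).card * (G.card - (L ∩ G).card).choose 2 : ℕ) : ℚ) := by push_cast; rfl
    have h2 : ∑ L ∈ lines M, ((eps (L ∩ G).card : ℚ) * ((crossPairs M G L).card : ℚ)) =
        ((∑ L ∈ lines M, eps (L ∩ G).card * (crossPairs M G L).card : ℕ) : ℚ) := by push_cast; rfl
    have h3 : ∑ P ∈ S, (lppCredit M G P : ℚ) = ((∑ P ∈ S, lppCredit M G P : ℕ) : ℚ) := by push_cast; rfl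
    rw [h1, h2, h3, ← Nat.cast_add]
    exact_mod_cast this
  -- F11: `F(g) = y_P·C(g,2)`, and `y_P ≥ 0`
  have F11 := Fg_eq_yPS hg hg'
  have hyP : 0 ≤ yPS G.card := yPS_nonneg _
  have hlpp : (0 : ℚ) ≤ lpp M G := Nat.cast_nonneg _
  have hcred : (0 : ℚ) ≤ ∑ P ∈ S, (lppCredit M G P : ℚ) := Finset.sum_nonneg (fun _ _ => Nat.cast_nonneg _)
  -- assemble
  have hyPC : yPS G.card * ∑ m ∈ Finset.Icc 2 6, (inc M G m : ℚ) * (m.choose 2 : ℚ) ≤ yPS G.card * (G.card.choose 2 : ℚ) :=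
    mul_le_mul_of_nonneg_left F7a hyP
  rw [F1]
  nlinarith [F2, F3, F4, F56, F7b, F7c, F8, F9, F10, F11, hyPC, hlpp, hcred]

end PercRepro.SixFour
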